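import Literature.NumberTheory.Automorphic.UnitaryGroupPrincipalSeriesH
import Literature.NumberTheory.Automorphic.SmoothInductionAdmissibleOfCocompact
import Literature.NumberTheory.Automorphic.UnitaryGroupCMLocalIwasawa
import Literature.NumberTheory.Automorphic.ParabolicGLReindex
import Literature.NumberTheory.Automorphic.SupercuspidalProjectiveGL
import Literature.NumberTheory.Automorphic.IrreducibleClassesBoxChar
import HarnessLib

/-!
# `i_H(χ₂ ⊠ χ₁)` is admissible: the principal series of `H_v = U(Φ₂)(L⁺_v) × U(Φ₁)(L⁺_v)` (Rogawski 1990 §12.1; Bernstein–Zelevinsky 1977 §2.3)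

Topic `NumberTheory/Automorphic`; namespace `Literature.NumberTheory.Automorphic.UnitaryGroup`.  THEOREMS ONLY (no definition, no instance, no notation, no named fact,
no `sorry`).  Cell `pub/hodgecm-mathlib`, line «CMCharIdentityTest» (F0P3b), (N-492) `stub_inducedCharTransfer` ∕ (N-H): every character computation
`(cmPrincipalSeriesH L v χ₂ χ₁).smoothTrace νH fH` (★ `Representation.smoothTrace_eq_integral_mul_levelTrace`, ★ `smoothTrace_eq_trace_levelActOp`, …) needs
ADMISSIBILITY of ★ `cmPrincipalSeriesH L v χ₂ χ₁ = (i_{U(Φ₂)}(χ₂) ∘ pr₁) ⊗ (χ₁ ∘ pr₂)`; here it is, for every `χ₂` and every `χ₁` with open kernel: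
★ `isAdmissible_cmPrincipalSeries_of_iwasawa` (admissibility of `i_{U(Φ₂)}(χ₂)`, from `G = B · K_v`, ★ `exists_borel_mul_mem_cmLocalIntegralLevel`) moved along the open
continuous projection `pr₁` (★ `IsAdmissible.comp_of_isOpenMap`) and twisted by the smooth character `χ₁ ∘ pr₂` (★ `Representation.IsAdmissible.twist`, ★ `isOpen_ker_comp_snd`).
* **`isAdmissible_cmPrincipalSeriesH`** — `(cmPrincipalSeriesH L v χ₂ χ₁).IsAdmissible` for `ker χ₁` open.
* `isSmooth_cmPrincipalSeriesH` — its smoothness (corollary).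
HONEST LABEL: HC_CM is proved only modulo the printed citations (2 remaining named inputs hLiu418, h413) until rung 0 closes; this file pays no letter by itself.

## References
* [Rogawski1990] J. D. Rogawski, *Automorphic Representations of Unitary Groups in Three Variables* (1990), §12.1 p. 171.
* [BernsteinZelevinsky1977] I. N. Bernstein, A. V. Zelevinsky, *Induced representations of reductive 𝔭-adic groups I*, §2.3.
-/

set_option autoImplicit false

noncomputable section

open NumberField IsDedekindDomain Topology

namespace Literature.NumberTheory.Automorphic

namespace UnitaryGroup

variable (L : Type) [Field L] [NumberField L] [IsCMField L] (v : HeightOneSpectrum (𝓞 ↥(maximalRealSubfield L)))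

set_option synthInstance.maxHeartbeats 400000 in
set_option maxHeartbeats 800000 in
/-- **`i_H(χ₂ ⊠ χ₁)` is admissible** for every character `χ₂` of the diagonal torus of `U(Φ₂)(L⁺_v)` and every character `χ₁` of `U(Φ₁)(L⁺_v)` with open kernel:
`i_{U(Φ₂)}(χ₂)` is admissible (★ `isAdmissible_cmPrincipalSeries_of_iwasawa`), pull-back along the open continuous `pr₁` preserves admissibility (★
`IsAdmissible.comp_of_isOpenMap`), and so does the twist by the smooth character `χ₁ ∘ pr₂` (★ `Representation.IsAdmissible.twist`).
[cite: Rogawski1990, §12.1 p. 171] [cite: BernsteinZelevinsky1977, §2.3] -/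
theorem isAdmissible_cmPrincipalSeriesH
    (χ₂ : ↥(torusU (conjLocal L (IsCMField.complexConj L) v) (cmLocalForm L 2 v)) →* ℂˣ)
    (χ₁ : (cmDatum L 1 (Matrix.of fun i j : Fin 1 => if i.val + j.val + 1 = 1 then (1 : L) else 0)).Local v →* ℂˣ)
    (hχ₁ : IsOpen (χ₁.ker : Set ((cmDatum L 1 (Matrix.of fun i j : Fin 1 => if i.val + j.val + 1 = 1 then (1 : L) else 0)).Local v))) :
    haveI := locallyCompactSpace_cmBorelU L 2 v
    (cmPrincipalSeriesH L v χ₂ χ₁).IsAdmissible := by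
  haveI := locallyCompactSpace_cmBorelU L 2 v
  have h2 : (cmPrincipalSeries L 2 v χ₂).IsAdmissible :=
    isAdmissible_cmPrincipalSeries_of_iwasawa L 2 v (exists_borel_mul_mem_cmLocalIntegralLevel L 2 v) χ₂
  have h2' := IsAdmissible.comp_of_isOpenMap (cmPrincipalSeries L 2 v χ₂)
    (MonoidHom.fst ((cmDatum L 2 (Matrix.of fun i j : Fin 2 => if i.val + j.val + 1 = 2 then (1 : L) else 0)).Local v)
      ((cmDatum L 1 (Matrix.of fun i j : Fin 1 => if i.val + j.val + 1 = 1 then (1 : L) else 0)).Local v))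
    continuous_fst isOpenMap_fst h2
  exact h2'.twist (isOpen_ker_comp_snd χ₁ hχ₁)

/-- `i_H(χ₂ ⊠ χ₁)` is smooth (`ker χ₁` open). [cite: Rogawski1990, §12.1 p. 171] -/
theorem isSmooth_cmPrincipalSeriesH
    (χ₂ : ↥(torusU (conjLocal L (IsCMField.complexConj L) v) (cmLocalForm L 2 v)) →* ℂˣ)
    (χ₁ : (cmDatum L 1 (Matrix.of fun i j : Fin 1 => if i.val + j.val + 1 = 1 then (1 : L) else 0)).Local v →* ℂˣ)
    (hχ₁ : IsOpen (χ₁.ker : Set ((cmDatum L 1 (Matrix.of fun i j : Fin 1 => if i.val + j.val + 1 = 1 then (1 : L) else 0)).Local v))) :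
    haveI := locallyCompactSpace_cmBorelU L 2 v
    (cmPrincipalSeriesH L v χ₂ χ₁).IsSmooth :=
  (isAdmissible_cmPrincipalSeriesH L v χ₂ χ₁ hχ₁).isSmooth

end UnitaryGroup

end Literature.NumberTheory.Automorphic

end
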